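import Summits.QuantumAdvantage.QuantumAdvantage.Theorems.LocusDialPieces
import Literature.Computability.MetaComplexity.RazborovSmolenskyApprox

/-!
# LocusDialDeclarable — DECLARABILITY: few-locus strategies are a.e. declarable in polylog degree WITHOUT stability

Cell decomp-qadv, seat lens-2, generation 17 — tree part (supports item stmt-QuantumAdvantage-27137
`Theses.StabilizerDial.FewLocusLoss3` = `Theorems.LocusDial.FewLocusLoss3`, piece `U`).

THE POINT.  Piece `U` (`FewLocusLoss3`) restricts `T` to strategies whose deviation set is a.e. covered by `m` windows of
width `r` at ARBITRARY locations; g15's PROVED `MultiAnchorLoss3` handles the windows that are DECLARED by low-degree anchor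
families which are a.e. unique AND flip-STABLE (`MAnchorable`).  This file shows that DECLARATION ITSELF IS FREE: with
`MFreeAnchorable m r c P` := `MAnchorable` minus its STAB clause (NEAR budget doubled), every degree-`(log₂ n)^c` strategy
that is few-locus at `(1, r)` is `MFreeAnchorable 1 r (c+2)` (`mFreeAnchorable_one_of_fewLocus`).  So «undeclarable loci» do
not exist at polylog degree, and the open content of `U` (at `m = 1`; general `m` by the same greedy recursion, not in this
file) is EXACTLY the missing STABILITY: `MFreeAnchorLoss3` (= `T` restricted to free-anchorable strategies, NECESSARY) GIVES
the one-window slice `FewLocusLossOne3` of `U` outright (`fewLocusLossOne3_of_mFreeAnchorLoss3`).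

§R1 RAZBOROV NOR APPROXIMANTS over low-degree `0/1`-valued functions `D_i` with an INPUT-AVERAGED seed: `razNor c I D =
∏_{t<ℓ} (1 - (Σ_{i∈I} c_{t,i} D_i)²)` (degree `ℓ·2d`, `razNor_mem`), exact on the all-zero pattern (`razNor_of_zero`), one-sided
(`forms_zero_of_razNor_ne_zero`), few erring seeds per input (`card_razErr_mul_le`: `#{c : err}·3^ℓ ≤ #seeds`, from the
Literature's hyperplane count `Smolensky.card_filter_linear_eq_zero_mul` and `card_filter_forall_mem`), and by DOUBLE COUNTING a
seed good for a whole list of `M` sub-families off a set of `≤ M·2^N/3^ℓ` inputs (`exists_good_razSeed`).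
§R2 DECLARABILITY at `m = 1`: deviation indicators `devPoly P i = t_i ⊕ [P_i = 1]` (degree `2 + 2d`), the GREEDY anchor family
`greedyAnc` (position `k > 0` declared iff it is the least deviation, position `0` iff it is the least deviation or there is
none; prefix NORs read through `razNor`), its degree (`greedyAnc_mem`, budget `greedy_degree_budget`), its semantics off the
error set (`greedyAnc_eq_one_iff` ↔ `IsDecl`, `card_isDecl`), the seed budget (`two_mul_log_budget`, `ℓ = 2 log₂ n`), and
**`mFreeAnchorable_one_of_fewLocus`** (`n ≥ 2^17`).
§R3 the law **`MFreeAnchorLoss3`** («a.e.-declared, possibly UNSTABLE windows lose»), `mFreeAnchorLoss3_of_polyLossOddU3`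
(necessity), the slice `FewLocusLossOne3` with `fewLocusLossOne3_of_fewLocusLoss3`, and **`fewLocusLossOne3_of_mFreeAnchorLoss3`**.
(The pointer edge `MFreeAnchorLoss3 → FreePointerLossAE3 → FreePointerLoss3` is the companion part `LocusDialDeclarablePointer`.)
Prop definitions = the node's pieces/leaves only (`MFreeAnchorable`, `RazErr`, `IsDecl` are plain predicates used in proofs).
No `sorry`; standard axioms; no instances, no notation.
-/

set_option linter.dupNamespace false

noncomputable section

open scoped Classical

namespace Summit.QuantumAdvantage.QuantumAdvantage.Theorems.LocusDial

open Finset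
open Literature.Computability.MetaComplexity Literature.Computability.MetaComplexity.Smolensky

variable {N A ℓ : ℕ}

/-! ## §R1  The Razborov NOR approximant of a sub-family -/

/-- Razborov's approximant of `NOR_{i ∈ I} D_i` with seed `c`: `∏_{t<ℓ} (1 - (Σ_{i∈I} c_{t,i} D_i)²)`. -/
def razNor (c : Fin ℓ → Fin A → ZMod 3) (I : Finset (Fin A)) (D : Fin A → CubeFn (ZMod 3) N) : CubeFn (ZMod 3) N :=
  ∏ t : Fin ℓ, (1 - (∑ i ∈ I, c t i • D i) ^ 2)

/-- LocusDialDeclarable helper `razNor_mem` (decomp-qadv land package; see the module docstring). -/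
theorem razNor_mem {d : ℕ} (c : Fin ℓ → Fin A → ZMod 3) (I : Finset (Fin A)) {D : Fin A → CubeFn (ZMod 3) N}
    (hD : ∀ i, D i ∈ lowDeg (ZMod 3) N d) : razNor c I D ∈ lowDeg (ZMod 3) N (ℓ * (2 * d)) := by
  unfold razNor
  have h := prod_mem_lowDeg (F := ZMod 3) (n := N) (univ : Finset (Fin ℓ))
    (u := fun t => 1 - (∑ i ∈ I, c t i • D i) ^ 2) (D := 2 * d) (fun t _ => ?_)
  · rwa [card_univ, Fintype.card_fin] at h
  · have hs : ∑ i ∈ I, c t i • D i ∈ lowDeg (ZMod 3) N d :=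
      Submodule.sum_mem _ fun i _ => Submodule.smul_mem _ _ (hD i)
    exact Submodule.sub_mem _ (one_mem_lowDeg _) (pow_mem_lowDeg hs 2)

/-- LocusDialDeclarable helper `razNor_apply` (decomp-qadv land package; see the module docstring). -/
theorem razNor_apply (c : Fin ℓ → Fin A → ZMod 3) (I : Finset (Fin A)) (D : Fin A → CubeFn (ZMod 3) N)
    (x : Fin N → Bool) : razNor c I D x = ∏ t : Fin ℓ, (1 - (∑ i ∈ I, c t i * D i x) ^ 2) := by
  unfold razNor
  rw [Finset.prod_apply]
  refine prod_congr rfl fun t _ => ?_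
  rw [Pi.sub_apply, Pi.pow_apply, Pi.one_apply, Finset.sum_apply]
  simp only [Pi.smul_apply, smul_eq_mul]

/-- exact on the all-zero pattern. -/
theorem razNor_of_zero (c : Fin ℓ → Fin A → ZMod 3) (I : Finset (Fin A)) (D : Fin A → CubeFn (ZMod 3) N)
    (x : Fin N → Bool) (h : ∀ i ∈ I, D i x = 0) : razNor c I D x = 1 := by
  rw [razNor_apply]
  refine prod_eq_one fun t _ => ?_
  rw [sum_eq_zero fun i hi => by rw [h i hi, mul_zero]]
  ring

/-- one-sided error: a nonzero value forces every trial form to vanish. -/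
theorem forms_zero_of_razNor_ne_zero (c : Fin ℓ → Fin A → ZMod 3) (I : Finset (Fin A)) (D : Fin A → CubeFn (ZMod 3) N)
    (x : Fin N → Bool) (h : razNor c I D x ≠ 0) (t : Fin ℓ) : ∑ i ∈ I, c t i * D i x = 0 := by
  by_contra hne
  apply h
  rw [razNor_apply]
  apply prod_eq_zero (mem_univ t)
  have hsq : ∀ s : ZMod 3, s ≠ 0 → 1 - s ^ 2 = 0 := by decide
  exact hsq _ hne

/-- the error event of seed `c` for the sub-family `I` at input `x`. -/
def RazErr (c : Fin ℓ → Fin A → ZMod 3) (I : Finset (Fin A)) (D : Fin A → CubeFn (ZMod 3) N) (x : Fin N → Bool) : Prop :=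
  razNor c I D x ≠ if ∀ i ∈ I, D i x = 0 then 1 else 0

/-- **few seeds err at a fixed input** (Razborov): `#{c : err} · 3^ℓ ≤ #seeds`. -/
theorem card_razErr_mul_le (I : Finset (Fin A)) (D : Fin A → CubeFn (ZMod 3) N) (x : Fin N → Bool) :
    (univ.filter fun c : Fin ℓ → Fin A → ZMod 3 => RazErr c I D x).card * 3 ^ ℓ ≤
      Fintype.card (Fin ℓ → Fin A → ZMod 3) := by
  by_cases h0 : ∀ i ∈ I, D i x = 0
  · have he : (univ.filter fun c : Fin ℓ → Fin A → ZMod 3 => RazErr c I D x) = ∅ := by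
      refine filter_eq_empty_iff.2 fun c _ hc => hc ?_
      rw [if_pos h0]
      exact razNor_of_zero c I D x h0
    rw [he, card_empty, zero_mul]
    exact Nat.zero_le _
  · push Not at h0
    obtain ⟨i₀, hi₀, hne⟩ := h0
    -- the vanishing hyperplane of one row
    set w : Fin A → ZMod 3 := fun i => if i ∈ I then D i x else 0 with hw
    set H := (univ : Finset (Fin A → ZMod 3)).filter (fun row => (∑ i, row (id i) * w i) = 0) with hH
    have hHcard : H.card * 3 = 3 ^ A :=
      card_filter_linear_eq_zero_mul (p := 3) id (fun _ _ h => h) w i₀ (by rw [hw]; simp [hi₀, hne])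
    have hsub : (univ.filter fun c : Fin ℓ → Fin A → ZMod 3 => RazErr c I D x) ⊆
        univ.filter fun c : Fin ℓ → Fin A → ZMod 3 => ∀ t, c t ∈ H := by
      intro c hc
      rw [mem_filter] at hc ⊢
      refine ⟨mem_univ _, fun t => ?_⟩
      rw [hH, mem_filter]
      refine ⟨mem_univ _, ?_⟩
      have hz : razNor c I D x ≠ 0 := by
        have := hc.2
        unfold RazErr at this
        rwa [if_neg (fun h => hne (h i₀ hi₀))] at this
      have hf := forms_zero_of_razNor_ne_zero c I D x hz t
      rw [← hf]
      rw [← sum_filter_add_sum_filter_not univ (fun i => i ∈ I)]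
      have h1 : (univ.filter fun i : Fin A => i ∈ I) = I := by ext i; simp
      rw [h1, sum_eq_zero (s := univ.filter fun i : Fin A => ¬ i ∈ I) (fun i hi => by
        rw [mem_filter] at hi; rw [hw]; simp [hi.2]), add_zero]
      exact sum_congr rfl fun i hi => by rw [hw]; simp [hi]
    calc (univ.filter fun c : Fin ℓ → Fin A → ZMod 3 => RazErr c I D x).card * 3 ^ ℓ
        ≤ (univ.filter fun c : Fin ℓ → Fin A → ZMod 3 => ∀ t, c t ∈ H).card * 3 ^ ℓ :=
          Nat.mul_le_mul_right _ (card_le_card hsub)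
      _ = (H.card * 3) ^ ℓ := by rw [card_filter_forall_mem H ℓ, mul_pow]
      _ = Fintype.card (Fin ℓ → Fin A → ZMod 3) := by
          rw [hHcard, Fintype.card_fun, Fintype.card_fin, Fintype.card_fun, Fintype.card_fin, ZMod.card]

/-- **an input-averaged good seed for a whole list of sub-families** (double counting): some seed errs, on ANY of the `M`
sub-families, on at most `M · 2^N / 3^ℓ` inputs. -/
theorem exists_good_razSeed {M : ℕ} (I : Fin M → Finset (Fin A)) (D : Fin A → CubeFn (ZMod 3) N) :
    ∃ c : Fin ℓ → Fin A → ZMod 3,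
      (univ.filter fun x : Fin N → Bool => ∃ a : Fin M, RazErr c (I a) D x).card * 3 ^ ℓ ≤ M * 2 ^ N := by
  set S := (univ : Finset (Fin ℓ → Fin A → ZMod 3)) with hS
  have hne : S.Nonempty := univ_nonempty
  -- the double count
  have hsum : ∑ c ∈ S, (univ.filter fun x : Fin N → Bool => ∃ a : Fin M, RazErr c (I a) D x).card * 3 ^ ℓ ≤
      S.card • (M * 2 ^ N) := by
    have h1 : ∀ c ∈ S, (univ.filter fun x : Fin N → Bool => ∃ a : Fin M, RazErr c (I a) D x).card ≤
        ∑ a : Fin M, (univ.filter fun x : Fin N → Bool => RazErr c (I a) D x).card := by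
      intro c _
      have hsub : (univ.filter fun x : Fin N → Bool => ∃ a : Fin M, RazErr c (I a) D x) ⊆
          (univ : Finset (Fin M)).biUnion (fun a => univ.filter fun x : Fin N → Bool => RazErr c (I a) D x) := by
        intro x hx
        rw [mem_filter] at hx
        obtain ⟨a, ha⟩ := hx.2
        exact mem_biUnion.2 ⟨a, mem_univ _, mem_filter.2 ⟨mem_univ _, ha⟩⟩
      exact le_trans (card_le_card hsub) card_biUnion_le
    have h2 : ∀ a : Fin M, ∑ c ∈ S, (univ.filter fun x : Fin N → Bool => RazErr c (I a) D x).card * 3 ^ ℓ ≤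
        2 ^ N * S.card := by
      intro a
      have hswap : ∑ c ∈ S, (univ.filter fun x : Fin N → Bool => RazErr c (I a) D x).card =
          ∑ x : Fin N → Bool, (univ.filter fun c : Fin ℓ → Fin A → ZMod 3 => RazErr c (I a) D x).card := by
        simp only [card_filter, hS]
        exact sum_comm
      rw [← sum_mul, hswap, sum_mul]
      have h3 := sum_le_sum fun x (_ : x ∈ (univ : Finset (Fin N → Bool))) => card_razErr_mul_le (ℓ := ℓ) (I a) D x
      refine le_trans h3 ?_
      rw [sum_const, card_univ, Fintype.card_fun, Fintype.card_bool, Fintype.card_fin, smul_eq_mul, hS, card_univ]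
    calc ∑ c ∈ S, (univ.filter fun x : Fin N → Bool => ∃ a : Fin M, RazErr c (I a) D x).card * 3 ^ ℓ
        ≤ ∑ c ∈ S, (∑ a : Fin M, (univ.filter fun x : Fin N → Bool => RazErr c (I a) D x).card) * 3 ^ ℓ :=
          sum_le_sum fun c hc => Nat.mul_le_mul_right _ (h1 c hc)
      _ = ∑ a : Fin M, ∑ c ∈ S, (univ.filter fun x : Fin N → Bool => RazErr c (I a) D x).card * 3 ^ ℓ := by
          rw [sum_comm]; exact sum_congr rfl fun c _ => sum_mul _ _ _
      _ ≤ ∑ a : Fin M, 2 ^ N * S.card := sum_le_sum fun a _ => h2 a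
      _ = S.card • (M * 2 ^ N) := by
          rw [sum_const, card_univ, Fintype.card_fin, smul_eq_mul, smul_eq_mul]; ring
  have hsum' : ∑ c ∈ S, (univ.filter fun x : Fin N → Bool => ∃ a : Fin M, RazErr c (I a) D x).card * 3 ^ ℓ ≤
      ∑ c ∈ S, M * 2 ^ N := by rwa [sum_const]
  obtain ⟨c, _, hc⟩ := exists_le_of_sum_le hne hsum'
  exact ⟨c, hc⟩

/-- outside the error set the approximant IS the NOR. -/
theorem razNor_eq_of_not_err (c : Fin ℓ → Fin A → ZMod 3) (I : Finset (Fin A)) (D : Fin A → CubeFn (ZMod 3) N)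
    (x : Fin N → Bool) (h : ¬ RazErr c I D x) : razNor c I D x = if ∀ i ∈ I, D i x = 0 then 1 else 0 := by
  unfold RazErr at h
  exact not_not.1 h

/-! ## §R2  DECLARABILITY at `m = 1`: every few-locus strategy is a.e. declarable in polylog degree WITHOUT stability -/

section Declarable

open Literature.Computability.QuantumComplexity Literature.Computability.QuantumComplexity.RingHLF
open Summit.QuantumAdvantage.AdviceFreeQNC0
open Summit.QuantumAdvantage.QuantumAdvantage.Theorems.HolonomyDial (selP selP_mem selP_apply xorP xorP_mem
  xorP_apply_bool tPoly tPoly_mem tPoly_apply)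
open Summit.QuantumAdvantage.QuantumAdvantage.Theorems.AnchorDial (dev MAnchorable)

/-- **`m`-FREE-ANCHORABLE**: `MAnchorable` with the STABILITY clause deleted (and the NEAR budget doubled): `m` declared anchor
families of degree `≤ (log₂ N)^c`, each a.e. UNIQUE, whose declared windows of width `r` cover the deviation set a.e. — the
declarations may be arbitrarily UNSTABLE under bit flips. -/
def MFreeAnchorable (m r c : ℕ) (P : Fin N → CubeFn (ZMod 3) N) : Prop :=
  ∃ A : Fin m → Fin N → CubeFn (ZMod 3) N,
    (∀ j k, A j k ∈ lowDeg (ZMod 3) N ((Nat.log 2 N) ^ c)) ∧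
    (∀ j, Nat.log 2 N * (univ.filter fun x : Fin N → Bool =>
        OddZeros x ∧ (univ.filter fun k : Fin N => A j k x = 1).card ≠ 1).card ≤ 2 ^ (N - 1)) ∧
    Nat.log 2 N * (univ.filter fun x : Fin N → Bool => OddZeros x ∧
        ¬ ∃ kv : Fin m → Fin N, (∀ j, A j (kv j) x = 1) ∧
          ∀ i ∈ dev P x, ∃ j, (kv j).val ≤ i.val ∧ i.val ≤ (kv j).val + r).card ≤ 2 ^ N

/-- the stable notion implies the free one. -/
theorem mFreeAnchorable_of_mAnchorable {m r c : ℕ} {P : Fin N → CubeFn (ZMod 3) N} (h : MAnchorable m r c P) :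
    MFreeAnchorable m r c P := by
  obtain ⟨A, hdeg, huniq, _, hnear⟩ := h
  refine ⟨A, hdeg, huniq, le_trans hnear ?_⟩
  exact Nat.pow_le_pow_right (by norm_num) (Nat.sub_le N 1)

/-- the deviation indicator `[i ∈ dev P x]` as a polynomial: `t_i ⊕ [P_i = 1]`. -/
def devPoly (P : Fin N → CubeFn (ZMod 3) N) (i : Fin N) : CubeFn (ZMod 3) N := xorP (tPoly i) (selP (P i))

/-- LocusDialDeclarable helper `devPoly_apply` (decomp-qadv land package; see the module docstring). -/
theorem devPoly_apply (P : Fin N → CubeFn (ZMod 3) N) (i : Fin N) (x : Fin N → Bool) :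
    devPoly P i x = if i ∈ dev P x then 1 else 0 := by
  unfold devPoly
  have hs : selP (P i) x = if decide (P i x = 1) then 1 else 0 := by
    rw [selP_apply]; by_cases h : P i x = 1 <;> simp [h]
  rw [xorP_apply_bool (tPoly i) (selP (P i)) x (tGuess x i) (decide (P i x = 1)) (tPoly_apply i x) hs]
  unfold dev
  simp only [mem_filter, mem_univ, true_and, ne_eq]
  cases tGuess x i <;> cases decide (P i x = 1) <;> simp

/-- LocusDialDeclarable helper `devPoly_mem` (decomp-qadv land package; see the module docstring). -/
theorem devPoly_mem {d : ℕ} {P : Fin N → CubeFn (ZMod 3) N} (hP : ∀ i, P i ∈ lowDeg (ZMod 3) N d) (i : Fin N) :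
    devPoly P i ∈ lowDeg (ZMod 3) N (2 + (d + d)) :=
  xorP_mem (tPoly_mem i) (selP_mem (hP i))

/-- LocusDialDeclarable helper `devPoly_zero_or_one` (decomp-qadv land package; see the module docstring). -/
theorem devPoly_zero_or_one (P : Fin N → CubeFn (ZMod 3) N) (i : Fin N) (x : Fin N → Bool) :
    devPoly P i x = 0 ∨ devPoly P i x = 1 := by
  rw [devPoly_apply]; split_ifs <;> simp

/-- the index sets of the prefix NORs: strictly-earlier positions (and, at position `0`, all LATER positions). -/
def preI (N : ℕ) (k : Fin N) : Finset (Fin N) :=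
  if k.val = 0 then univ.filter fun i : Fin N => 0 < i.val else univ.filter fun i : Fin N => i.val < k.val

/-- the GREEDY (leftmost) anchor family read through Razborov approximants with seed `c`:
position `k > 0` is declared iff `k` is the least deviation; position `0` iff it is the least deviation OR there is none. -/
def greedyAnc (P : Fin N → CubeFn (ZMod 3) N) (c : Fin ℓ → Fin N → ZMod 3) (k : Fin N) : CubeFn (ZMod 3) N :=
  if k.val = 0 then 1 - (1 - devPoly P k) * (1 - razNor c (preI N k) (devPoly P))
  else devPoly P k * razNor c (preI N k) (devPoly P)

/-- LocusDialDeclarable helper `greedyAnc_mem` (decomp-qadv land package; see the module docstring). -/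
theorem greedyAnc_mem {d : ℕ} {P : Fin N → CubeFn (ZMod 3) N} (hP : ∀ i, P i ∈ lowDeg (ZMod 3) N d)
    (c : Fin ℓ → Fin N → ZMod 3) (k : Fin N) :
    greedyAnc P c k ∈ lowDeg (ZMod 3) N ((2 + (d + d)) + ℓ * (2 * (2 + (d + d)))) := by
  have hD := devPoly_mem hP
  have hR := razNor_mem c (preI N k) hD
  unfold greedyAnc
  split_ifs
  · refine Submodule.sub_mem _ (one_mem_lowDeg _) (mul_mem_lowDeg_add ?_ ?_)
    · exact Submodule.sub_mem _ (one_mem_lowDeg _) (hD k)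
    · exact Submodule.sub_mem _ (one_mem_lowDeg _) hR
  · exact mul_mem_lowDeg_add (hD k) hR


end Declarable
end Summit.QuantumAdvantage.QuantumAdvantage.Theorems.LocusDial
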